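import Summits.BirchSwinnertonDyer.Rank1Residual.P2.CongruentNumberPairsAtTwoHalvingBitsDoor
import HarnessLib

/-!
# Sub-lane «bsd-p2»: the PER-PAIR DISCHARGE LEMMAS for the halving bits `b₁(s)`, `b₂(s)` of the
# halving-bits door `P2/CongruentNumberPairsAtTwoHalvingBitsDoor.lean` (p350663), read on the tree's
# complete `2`-descent map `δ(P) = (x(P) + n, x(P))` of `E_n : y² = x³ − n²x` — pure `2`-descent algebra
# over `ℚ` from tree theorems (0 def; 0 facts; 0 (K); no pair, no numeral of a census cell)

HONEST FRAMING (sub-lane «bsd-p2», run/shared/lean/b2b/bsd-rank1-residual/p2/, verbatim in every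
file): the target of record is the FULL Birch–Swinnerton-Dyer formula for EVERY analytic-rank `≤ 1`
`E/ℚ` at ALL primes INCLUDING `2`; the odd-prime class ledger is referee A's; the `2`-part is OPEN
(cells O1 = X5 ∖ CM and O12 = the CM corner) and under census by «bsd-p2». Census / instrument
output at `2` = EVIDENCE / conjecture items with held-out validation, NEVER a Literature fact;
certificates close PAIRS (one isogeny class, `p = 2`), never classes. THIS FILE is unconditional
`2`-descent algebra on `E_n(ℚ)` from tree theorems (`Affine.Point.ker_twoDescentMap` = Silverman AEC
Prop. X.1.4, PROVED in the tree; `TwoDescentLocal.splitTwoTorsion_cn`, `TwoDescentLocal.point_cases_cn`;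
Knapp 4.20 `E_n(ℚ)_tors = E_n[2]` via `two_nsmul_eq_zero_of_mem_torsion_congruentNumberCurve`). It
closes NO pair, states no conjecture, adds no fact, displays no hypothesis, touches no (K) / mark /
tier. Its only purpose: to make the hypotheses `b₁(s)`, `¬ b₂(s)` of the halving-bits door
`rankOne_sha_bsdp_two_iff_halvingBits_congruentNumberCurve_two_mul_three_primes` (p350663 §4,
`BSD(E_n, 2) ⟺ b₁(s) ∧ ¬ b₂(s)` GIVEN `T_even`) DECIDABLE PER PAIR by two rational square roots and
four quadratic-character (square-class) comparisons, WITHOUT a generator of `E_n(ℚ)` and without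
`L`-numerics. A per-pair certificate assembled through §4 below would still be «`BSD₂(E_n)` modulo
`T_even` (`hT`, PRINTED-ASSERTED: LEMMA (I)-even ∘ Tian–Yuan–Zhang Thm 3.3, displayed per pair, never
discharged in the tree), `hGZK`, `hMe`» — never unconditional. `hT` is untouched here.

THE BITS (p350663 §3–§4). For `s ∈ E_n(ℚ)`: `b_j(s) := ∃ T R, 2 • T = O ∧ s + T = 2^j • R`
(«`s ∈ 2^j E_n(ℚ) + E_n[2]`»). THE DESCENT MAP (tree, `Literature/…/TwoDescent.lean`): for the split
`2`-torsion `e₁ = −n, e₂ = 0, e₃ = n` of `E_n`, `δ = (δ₁, δ₂) : E_n(ℚ) →+ (ℚˣ/ℚˣ²)²`,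
`δ(x, y) = (x + n, x)` for `x ∉ {−n, 0}` (§2), with kernel EXACTLY `2E_n(ℚ)`.

THE PER-PAIR RECIPE (prose; nothing of it is instantiated in this file). Given an even `ℓ = 3` cell
`n = 2p₀p₁p₂ ≡ 6 (mod 8)` with `s(n) = 1` (kernel-decided as in p347324) and an explicit affine point
`s = (x_s, y_s) ∈ E_n(ℚ)`, `y_s ≠ 0` (so `2 • s ≠ O`, §1):
* `b₁(s)` ⟺ `δ(s) ∈ δ(E_n[2]) = {(1, 1), (2, −n), (n, −1), (2n, n)}` (square classes; §2–§3:
  `halvingBit_one_iff_twoDescentMap` + `exists_two_torsion_twoDescentMap_eq_iff`), i.e. for ONE of the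
  four `T ∈ E_n[2]` the two rationals `(x_s + n)·δ₁(T)`, `x_s·δ₂(T)` are squares — two exhibited square
  roots (`sqClass_eq_one_iff`, `sqClass_eq_mul_of_mul_mul_eq_sq`);
* `¬ b₂(s)`: exhibit ONE half `R₀ = (x_R, y_R)` with `2 • R₀ = s + T₀`, `T₀ ∈ E_n[2]` (Mathlib's group
  law evaluates `2 • R₀` by `norm_num` on coordinates); then `b₂(s) ⟺ δ(R₀) ∈ δ(E_n[2])` (§3:
  `halvingBit_two_iff_twoDescentMap`, because the halves of `s + T₀` are `R₀ + E_n(ℚ)_tors = R₀ + E_n[2]`),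
  so `¬ b₂(s)` ⟺ `(x_R + n, x_R)` avoids the four classes — one non-square witness (a prime at which the
  valuation is odd, or a sign) per class;
* then §4 (`rankOne_sha_bsdp_two_of_twoDescent_congruentNumberCurve_two_mul_three_primes`) assembles
  `ord_{s=1} L(E_n, s) = 1 ∧ rank = 1 ∧ Ш(E_n)[2^∞] = 0 ∧ BSD(E_n, 2)` from the door, MODULO `hGZK`, `hMe`
  and the displayed `hT`.
Statements carry an arbitrary `DecidableEq ℚ` instance (`[inst : DecidableEq ℚ]`, the instance
Mathlib's group law on `E_n(ℚ)` uses; tree idiom of `TwoDescentLinearConditions`), so that they apply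
verbatim to points written with numerals. Cell `openO12` (CM, `2` ramified); per-pair statements close
no class. Nothing booked; no mark moved. Unit `b2b-bsdres-p2-typer` GEN 15, landed on p2-lead
WAKE-T-144 @7ecf7a70ed19ff09 (GO for the GEN 14 scratch `p2/typer/lean/conjectures/HalvingBitsDescent.scratch.lean`
@8ac31bcc3191b14f, memo `T142-CERT-SHAPE.md` @5de0ac4dc0e5c52a §(B)(iii)/§(D)); infrastructure for the
lane's SWEEP item (ε′) whichever way it rules on per-pair `hT`-doors. NEW file; coordinates: p350663
(the door), p347324 (the even `ℓ = 3` door over census vocabulary), p2-idea-2 REVIEW-I2-105 §E.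

References: [SilvermanAEC2009] Prop. X.1.4, Thm. VIII.9.3; [Knapp1993] Lemma 4.20;
[Monsky1990MockHeegner] Remark (3) (p. 67); [Miller2011LMS] Def. 1.1; HOME `p2/STRUCTURE-p2.md` v0.13
§7; `p2/LEAD-OKS.md` T-142, T-143, T-144.
-/

noncomputable section

open WeierstrassCurve WeierstrassCurve.Affine WeierstrassCurve.Affine.Point
  Literature.NumberTheory.EllipticCurves Literature.NumberTheory.EllipticCurves.TwoDescentLocal
  Literature.NumberTheory.EllipticCurves.Rank1Residual
  Literature.NumberTheory.EllipticCurves.Rank1Residual.Typed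
  Literature.NumberTheory.EllipticCurves.HeathBrown1994

set_option autoImplicit false

namespace Summit.BirchSwinnertonDyer.Rank1Residual.P2

section Descent

variable [inst : DecidableEq ℚ] {n : ℕ}

/-! ## §1 The `2`-torsion of `E_n(ℚ)`: `2 • T = O ⟺ T = O ∨ y(T) = 0 ⟺ T ∈ {O, (−n,0), (0,0), (n,0)}` -/

/-- On `E_n` (`n ≠ 0`): `2 • T = O ⟺ T = O ∨ y(T) = 0` (a point with `y ≠ 0` doubles to an AFFINE
point; `a₁ = a₃ = 0` so `−(x, y) = (x, −y)`). In particular an explicit `s = (x, y)` with `y ≠ 0` has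
`2 • s ≠ O` — the door's hypothesis `hs2`. [cite: Knapp1993, Lemma 4.20]
[cite: SilvermanAEC2009, Group Law Algorithm III.2.3] -/
theorem two_nsmul_eq_zero_iff_congruentNumberCurve (hn : n ≠ 0)
    (T : (congruentNumberCurve n).toAffine.Point) :
    (2 : ℕ) • T = 0 ↔ T = 0 ∨ ∃ (x y : ℚ) (h : (congruentNumberCurve n).toAffine.Nonsingular x y),
      T = .some x y h ∧ y = 0 := by
  haveI := isElliptic_congruentNumberCurve hn
  have hneg : ∀ x y : ℚ, (congruentNumberCurve n).toAffine.negY x y = -y := fun x y => by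
    rw [negY, cn_affine_a₁, cn_affine_a₃]; ring
  constructor
  · intro h2
    rcases point_cases_cn hn T with h | h | h | h | ⟨x, y, hP, rfl, -, -, -, hy, -⟩
    · exact Or.inl h
    · exact Or.inr ⟨_, _, _, h, by rw [twoTorsionY, cn_affine_a₁, cn_affine_a₃]; ring⟩
    · exact Or.inr ⟨_, _, _, h, by rw [twoTorsionY, cn_affine_a₁, cn_affine_a₃]; ring⟩
    · exact Or.inr ⟨_, _, _, h, by rw [twoTorsionY, cn_affine_a₁, cn_affine_a₃]; ring⟩
    · exfalso
      have hy' : y ≠ (congruentNumberCurve n).toAffine.negY x y := by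
        rw [hneg]; intro h; apply hy; linarith
      rw [two_nsmul, add_self_of_Y_ne hy'] at h2
      exact some_ne_zero _ h2
  · rintro (rfl | ⟨x, y, h, rfl, rfl⟩)
    · exact nsmul_zero 2
    · rw [two_nsmul]
      exact add_self_of_Y_eq (by rw [hneg]; ring)

/-- On `E_n` (`n ≠ 0`): `2 • T = O ⟺ T ∈ {O, T₋ₙ, T₀, Tₙ}` with `T₋ₙ = (−n, 0)`, `T₀ = (0, 0)`,
`Tₙ = (n, 0)` the three rational `2`-torsion points of the tree's split `splitTwoTorsion_cn n`
(so «`∃ T, 2 • T = O ∧ …`» is a four-way disjunction). [cite: Knapp1993, Lemma 4.20] -/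
theorem two_nsmul_eq_zero_iff_eq_twoTorsion_congruentNumberCurve (hn : n ≠ 0)
    (T : (congruentNumberCurve n).toAffine.Point) :
    haveI := isElliptic_congruentNumberCurve hn
    (2 : ℕ) • T = 0 ↔ T = 0 ∨ T = .some _ _ (nonsingular_twoTorsion (splitTwoTorsion_cn n)) ∨
      T = .some _ _ (nonsingular_twoTorsion (splitTwoTorsion_cn n).swap₁₂) ∨
      T = .some _ _ (nonsingular_twoTorsion (splitTwoTorsion_cn n).swap₂₃.swap₁₂) := by
  haveI := isElliptic_congruentNumberCurve hn
  have hY : ∀ e : ℚ, (congruentNumberCurve n).toAffine.twoTorsionY e = 0 := fun e => by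
    rw [twoTorsionY, cn_affine_a₁, cn_affine_a₃]; ring
  constructor
  · intro h2
    rcases point_cases_cn hn T with h | h | h | h | ⟨x, y, hP, rfl, -, -, -, hy, -⟩
    · exact Or.inl h
    · exact Or.inr (Or.inl h)
    · exact Or.inr (Or.inr (Or.inl h))
    · exact Or.inr (Or.inr (Or.inr h))
    · exfalso
      rcases (two_nsmul_eq_zero_iff_congruentNumberCurve hn _).mp h2 with h | ⟨x', y', h', he, hy0⟩
      · exact some_ne_zero _ h
      · simp only [Point.some.injEq] at he
        exact hy (he.2.trans hy0)
  · rintro (rfl | rfl | rfl | rfl)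
    · exact nsmul_zero 2
    all_goals exact (two_nsmul_eq_zero_iff_congruentNumberCurve hn _).mpr (Or.inr ⟨_, _, _, rfl, hY _⟩)

/-! ## §2 The descent map `δ` on `E_n`: values on affine points and on the `2`-torsion; `δ + δ = 0` -/

/-- `δ` takes values in a group of exponent `2`: `δ P + δ P = 0`. [folklore] -/
theorem twoDescentMap_add_self (hn : n ≠ 0) (P : (congruentNumberCurve n).toAffine.Point) :
    haveI := isElliptic_congruentNumberCurve hn
    twoDescentMap (splitTwoTorsion_cn n) P + twoDescentMap (splitTwoTorsion_cn n) P = 0 := by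
  haveI := isElliptic_congruentNumberCurve hn
  rw [twoDescentMap_apply, ← ofMul_mul, Prod.mk_mul_mk, SqUnits.mul_self, SqUnits.mul_self]
  rfl

/-- **`δ` on an affine point off the `2`-torsion abscissae `−n, 0`:** `δ(x, y) = (x + n, x)` as a pair
of square classes (Silverman's `(x − e₁, x − e₂)` with `e₁ = −n`, `e₂ = 0`). This is the pair of
rationals a per-pair certificate reads off an exhibited point. [cite: SilvermanAEC2009, Prop. X.1.4] -/
theorem twoDescentMap_some_congruentNumberCurve (hn : n ≠ 0) {x y : ℚ}
    (h : (congruentNumberCurve n).toAffine.Nonsingular x y) (hx₁ : x ≠ -(n : ℚ)) (hx₂ : x ≠ 0) :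
    haveI := isElliptic_congruentNumberCurve hn
    twoDescentMap (splitTwoTorsion_cn n) (.some x y h) =
      Additive.ofMul (sqClass (x + n), sqClass x) := by
  haveI := isElliptic_congruentNumberCurve hn
  rw [twoDescentMap_apply, twoDescentComponent_some_of_ne _ hx₁, twoDescentComponent_some_of_ne _ hx₂,
    sub_neg_eq_add, sub_zero]

/-- **The descent classes of the `2`-torsion of `E_n`** (`δ = (δ₁, δ₂)`, `δ₁ ↔ e₁ = −n`, `δ₂ ↔ e₂ = 0`,
Silverman's conventions at `T₁, T₂`): `δ(−n, 0) = (2n², −n)`, `δ(0, 0) = (n, −n²)`, `δ(n, 0) = (2n, n)`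
as square classes — i.e. `δ(E_n[2]) = {(1, 1), (2, −n), (n, −1), (2n, n)}` modulo squares, the four
classes a pair's `δ(s)` / `δ(R₀)` is compared with. [cite: SilvermanAEC2009, Prop. X.1.4] -/
theorem twoDescentMap_twoTorsion_congruentNumberCurve (hn : n ≠ 0) :
    haveI := isElliptic_congruentNumberCurve hn
    twoDescentMap (splitTwoTorsion_cn n) (.some _ _ (nonsingular_twoTorsion (splitTwoTorsion_cn n))) =
        Additive.ofMul (sqClass (2 * (n : ℚ) ^ 2), sqClass (-(n : ℚ))) ∧
      twoDescentMap (splitTwoTorsion_cn n)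
          (.some _ _ (nonsingular_twoTorsion (splitTwoTorsion_cn n).swap₁₂)) =
        Additive.ofMul (sqClass (n : ℚ), sqClass (-(n : ℚ) ^ 2)) ∧
      twoDescentMap (splitTwoTorsion_cn n)
          (.some _ _ (nonsingular_twoTorsion (splitTwoTorsion_cn n).swap₂₃.swap₁₂)) =
        Additive.ofMul (sqClass (2 * (n : ℚ)), sqClass (n : ℚ)) := by
  haveI := isElliptic_congruentNumberCurve hn
  have hn' : (n : ℚ) ≠ 0 := by exact_mod_cast hn
  refine ⟨?_, ?_, ?_⟩
  · rw [twoDescentMap_apply, twoDescentComponent_some_of_eq _ rfl,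
      twoDescentComponent_some_of_ne _ (by simpa using hn')]
    congr 2
    · ring_nf
    · ring_nf
  · rw [twoDescentMap_apply, twoDescentComponent_some_of_ne _ (by simpa using hn),
      twoDescentComponent_some_of_eq _ rfl]
    congr 2
    · ring_nf
    · ring_nf
  · rw [twoDescentMap_apply,
      twoDescentComponent_some_of_ne _ (by
        intro h; apply hn'; linarith),
      twoDescentComponent_some_of_ne _ (by simpa using hn')]
    congr 2
    · ring_nf
    · ring_nf

/-- **«`δ P ∈ δ(E_n[2])`» unfolded into FOUR square-class comparisons:**
`(∃ T, 2 • T = O ∧ δ P = δ T) ⟺ δ P = (1, 1) ∨ δ P = (2n², −n) ∨ δ P = (n, −n²) ∨ δ P = (2n, n)`.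
[cite: SilvermanAEC2009, Prop. X.1.4] [cite: Knapp1993, Lemma 4.20] -/
theorem exists_two_torsion_twoDescentMap_eq_iff (hn : n ≠ 0) (P : (congruentNumberCurve n).toAffine.Point) :
    haveI := isElliptic_congruentNumberCurve hn
    (∃ T : (congruentNumberCurve n).toAffine.Point, (2 : ℕ) • T = 0 ∧
        twoDescentMap (splitTwoTorsion_cn n) P = twoDescentMap (splitTwoTorsion_cn n) T) ↔
      twoDescentMap (splitTwoTorsion_cn n) P = 0 ∨
        twoDescentMap (splitTwoTorsion_cn n) P =
          Additive.ofMul (sqClass (2 * (n : ℚ) ^ 2), sqClass (-(n : ℚ))) ∨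
        twoDescentMap (splitTwoTorsion_cn n) P =
          Additive.ofMul (sqClass (n : ℚ), sqClass (-(n : ℚ) ^ 2)) ∨
        twoDescentMap (splitTwoTorsion_cn n) P =
          Additive.ofMul (sqClass (2 * (n : ℚ)), sqClass (n : ℚ)) := by
  haveI := isElliptic_congruentNumberCurve hn
  obtain ⟨h₁, h₂, h₃⟩ := twoDescentMap_twoTorsion_congruentNumberCurve hn
  constructor
  · rintro ⟨T, hT, h⟩
    rcases (two_nsmul_eq_zero_iff_eq_twoTorsion_congruentNumberCurve hn T).mp hT with
      rfl | rfl | rfl | rfl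
    · exact Or.inl (by rw [h, _root_.map_zero])
    · exact Or.inr (Or.inl (by rw [h, h₁]))
    · exact Or.inr (Or.inr (Or.inl (by rw [h, h₂])))
    · exact Or.inr (Or.inr (Or.inr (by rw [h, h₃])))
  · rintro (h | h | h | h)
    · exact ⟨0, nsmul_zero 2, by rw [h, _root_.map_zero]⟩
    · exact ⟨_, (two_nsmul_eq_zero_iff_eq_twoTorsion_congruentNumberCurve hn _).mpr
        (Or.inr (Or.inl rfl)), by rw [h, h₁]⟩
    · exact ⟨_, (two_nsmul_eq_zero_iff_eq_twoTorsion_congruentNumberCurve hn _).mpr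
        (Or.inr (Or.inr (Or.inl rfl))), by rw [h, h₂]⟩
    · exact ⟨_, (two_nsmul_eq_zero_iff_eq_twoTorsion_congruentNumberCurve hn _).mpr
        (Or.inr (Or.inr (Or.inr rfl))), by rw [h, h₃]⟩

/-! ## §3 The halving bits on the descent map: `b₁(s)` from `δ(s)`, `b₂(s)` from `δ` of ONE half -/

/-- **`b₁` on the descent map.** For `s ∈ E_n(ℚ)`:
`(∃ T R, 2 • T = O ∧ s + T = 2 • R) ⟺ ∃ T, 2 • T = O ∧ δ s = δ T` — `s` is halvable modulo `E_n[2]`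
iff its descent class `(x(s) + n, x(s))` is one of the four classes `δ(E_n[2])` (§2). Through the
door's `exists_eq_two_nsmul_iff_twoDescentMap_eq_zero` (p350663 §5 = Silverman X.1.4 in the tree).
Per pair: exhibit `T` and two rational square roots. [cite: SilvermanAEC2009, Prop. X.1.4] -/
theorem halvingBit_one_iff_twoDescentMap (hn : n ≠ 0) (s : (congruentNumberCurve n).toAffine.Point) :
    haveI := isElliptic_congruentNumberCurve hn
    (∃ T R : (congruentNumberCurve n).toAffine.Point, (2 : ℕ) • T = 0 ∧ s + T = (2 : ℕ) • R) ↔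
      ∃ T : (congruentNumberCurve n).toAffine.Point, (2 : ℕ) • T = 0 ∧
        twoDescentMap (splitTwoTorsion_cn n) s = twoDescentMap (splitTwoTorsion_cn n) T := by
  haveI := isElliptic_congruentNumberCurve hn
  have key : ∀ T : (congruentNumberCurve n).toAffine.Point,
      (∃ R : (congruentNumberCurve n).toAffine.Point, s + T = (2 : ℕ) • R) ↔
        twoDescentMap (splitTwoTorsion_cn n) s = twoDescentMap (splitTwoTorsion_cn n) T := by
    intro T
    rw [exists_eq_two_nsmul_iff_twoDescentMap_eq_zero hn, map_add]
    constructor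
    · intro h
      have := twoDescentMap_add_self hn T
      -- `δ s + δ T = 0` and `δ T + δ T = 0` give `δ s = δ T`
      have h' : twoDescentMap (splitTwoTorsion_cn n) s =
          twoDescentMap (splitTwoTorsion_cn n) s + (twoDescentMap (splitTwoTorsion_cn n) T +
            twoDescentMap (splitTwoTorsion_cn n) T) := by rw [this, add_zero]
      rw [h', ← add_assoc, h, zero_add]
    · intro h
      rw [h]
      exact twoDescentMap_add_self hn T
  constructor
  · rintro ⟨T, R, hT, hR⟩
    exact ⟨T, hT, (key T).mp ⟨R, hR⟩⟩
  · rintro ⟨T, hT, h⟩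
    obtain ⟨R, hR⟩ := (key T).mpr h
    exact ⟨T, R, hT, hR⟩

/-- **`b₂` on the descent map, given ONE half.** If `2 • R₀ = s + T₀` with `2 • T₀ = O` (`n`
square-free), then `(∃ T R, 2 • T = O ∧ s + T = 4 • R) ⟺ ∃ T, 2 • T = O ∧ δ R₀ = δ T`: the halves of
`s + T₀` are `R₀ + E_n(ℚ)_tors = R₀ + E_n[2]` (Knapp 4.20, the door's
`two_nsmul_eq_zero_of_mem_torsion_congruentNumberCurve`), so `b₂(s) = b₁(R₀)` and §3's first lemma
applies to `R₀`. Hence `¬ b₂(s)` = «`δ R₀` avoids the four classes of §2» — one non-square witness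
each. [cite: SilvermanAEC2009, Prop. X.1.4]
[cite: Knapp1993, Lemma 4.20] -/
theorem halvingBit_two_iff_twoDescentMap (hsq : Squarefree n)
    (s R₀ T₀ : (congruentNumberCurve n).toAffine.Point) (hT₀ : (2 : ℕ) • T₀ = 0)
    (hR₀ : (2 : ℕ) • R₀ = s + T₀) :
    haveI := isElliptic_congruentNumberCurve hsq.ne_zero
    (∃ T R : (congruentNumberCurve n).toAffine.Point, (2 : ℕ) • T = 0 ∧ s + T = (4 : ℕ) • R) ↔
      ∃ T : (congruentNumberCurve n).toAffine.Point, (2 : ℕ) • T = 0 ∧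
        twoDescentMap (splitTwoTorsion_cn n) R₀ = twoDescentMap (splitTwoTorsion_cn n) T := by
  have hn : n ≠ 0 := hsq.ne_zero
  haveI := isElliptic_congruentNumberCurve hn
  rw [← halvingBit_one_iff_twoDescentMap hn R₀]
  have h4 : ∀ P : (congruentNumberCurve n).toAffine.Point, (4 : ℕ) • P = (2 : ℕ) • ((2 : ℕ) • P) :=
    fun P => by rw [show (4 : ℕ) = 2 * 2 from rfl, mul_nsmul]
  constructor
  · rintro ⟨T, R, hT, hR⟩
    -- `Q := 2 • R − R₀` has `2 • Q = T − T₀`, so `4 • Q = 0`: `Q` is torsion, hence `2 • Q = 0`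
    have h2Q : (2 : ℕ) • ((2 : ℕ) • R - R₀) = T - T₀ := by
      rw [nsmul_sub, ← h4, ← hR, hR₀]; abel
    have h4Q : (4 : ℕ) • ((2 : ℕ) • R - R₀) = 0 := by
      rw [h4, h2Q, nsmul_sub, hT, hT₀, sub_zero]
    have hQ : (2 : ℕ) • ((2 : ℕ) • R - R₀) = 0 :=
      two_nsmul_eq_zero_of_mem_torsion_congruentNumberCurve hsq _
        ((AddCommGroup.mem_torsion _).mpr (isOfFinAddOrder_iff_nsmul_eq_zero.mpr ⟨4, by norm_num, h4Q⟩))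
    exact ⟨(2 : ℕ) • R - R₀, R, hQ, by abel⟩
  · rintro ⟨T, R, hT, hR⟩
    refine ⟨T₀, R, hT₀, ?_⟩
    have hR₀' : R₀ = (2 : ℕ) • R - T := by rw [← hR]; abel
    rw [← hR₀, hR₀', nsmul_sub, hT, sub_zero, h4]

/-- **`¬ b₂` from four character evaluations.** With `R₀, T₀` as above: if `δ R₀` differs from
`δ T` for every `T` with `2 • T = O` (by §2, four explicit square-class inequalities), then
`s ∉ 4E_n(ℚ) + E_n[2]`. [cite: SilvermanAEC2009, Prop. X.1.4] [cite: Knapp1993, Lemma 4.20] -/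
theorem not_halvingBit_two_of_twoDescentMap_ne (hsq : Squarefree n)
    (s R₀ T₀ : (congruentNumberCurve n).toAffine.Point) (hT₀ : (2 : ℕ) • T₀ = 0)
    (hR₀ : (2 : ℕ) • R₀ = s + T₀)
    (h : haveI := isElliptic_congruentNumberCurve hsq.ne_zero
      ∀ T : (congruentNumberCurve n).toAffine.Point, (2 : ℕ) • T = 0 →
        twoDescentMap (splitTwoTorsion_cn n) R₀ ≠ twoDescentMap (splitTwoTorsion_cn n) T) :
    ¬ ∃ T R : (congruentNumberCurve n).toAffine.Point, (2 : ℕ) • T = 0 ∧ s + T = (4 : ℕ) • R := by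
  rw [halvingBit_two_iff_twoDescentMap hsq s R₀ T₀ hT₀ hR₀]
  rintro ⟨T, hT, he⟩
  exact h T hT he

end Descent

/-! ## §4 Schema: how a per-pair certificate is ASSEMBLED through the door (no pair instantiated here) -/

section Schema

variable [inst : DecidableEq ℚ]

/-- **ASSEMBLY SCHEMA (even `ℓ = 3`; modulo `hGZK`, `hMe` and the DISPLAYED `hT`).** The door
`rankOne_sha_bsdp_two_iff_halvingBits_congruentNumberCurve_two_mul_three_primes` (p350663 §4) with its
bits discharged on the descent map: given the cell data (`n = 2p₀p₁p₂ ≡ 6 (mod 8)`, distinct primes,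
`s(n) = monskySelmerRankEven p = 1`), an explicit `s ∈ E_n(ℚ)` with `2 • s ≠ O`, the displayed
`T_even` hypothesis `hT : L′(E_n, 1) = 4·Ω·ĥ(s)`, `n ≠ 0` (to state `δ`; it follows from the cell
data anyway), a `2`-torsion point `T₁` with `δ s = δ T₁` (⟹ `b₁`),
and ONE half `R₀` of `s + T₀` (`2 • T₀ = O`) whose class `δ R₀` avoids `δ(E_n[2])` (⟹ `¬ b₂`):
`ord_{s=1} L(E_n, s) = 1`, rank `1`, `Ш(E_n)[2^∞] = 0` and `BSD(E_n, 2)`. CONDITIONAL on `hT`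
(PRINTED-ASSERTED, never discharged in the tree): a pair closed this way is «`BSD₂(E_n)` modulo
`T_even(n)`, GZK, Monsky's even matrix theorem», nothing more; no numeral of a census cell appears in
this file. [cite: Monsky1990MockHeegner, Remark (3) (p. 67)] [cite: SilvermanAEC2009, Prop. X.1.4]
[cite: Miller2011LMS, Def. 1.1 (arXiv:1010.2431 p. 3)] -/
theorem rankOne_sha_bsdp_two_of_twoDescent_congruentNumberCurve_two_mul_three_primes
    (hGZK : rank_eq_analyticRank_of_analyticRank_le_one) (hMe : monsky_card_selmerGroup_two_even)
    (p : Fin 3 → ℕ) (hp : ∀ i, (p i).Prime) (hinj : Function.Injective p) {n : ℕ}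
    (hn : 2 * ∏ i, p i = n) (h8 : n % 8 = 6) (hs : monskySelmerRankEven p = 1) (hn0 : n ≠ 0)
    (s : (congruentNumberCurve n).toAffine.Point) (hs2 : (2 : ℕ) • s ≠ 0)
    (hT : deriv (congruentNumberCurve n).entireLFunction 1 =
      (4 : ℂ) * ((congruentNumberCurve n).realPeriodRat : ℂ) * (s.canonicalHeight : ℂ))
    (T₁ : (congruentNumberCurve n).toAffine.Point) (hT₁ : (2 : ℕ) • T₁ = 0)
    (hδ₁ : haveI := isElliptic_congruentNumberCurve hn0
      twoDescentMap (splitTwoTorsion_cn n) s = twoDescentMap (splitTwoTorsion_cn n) T₁)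
    (R₀ T₀ : (congruentNumberCurve n).toAffine.Point) (hT₀ : (2 : ℕ) • T₀ = 0)
    (hR₀ : (2 : ℕ) • R₀ = s + T₀)
    (hδ₂ : haveI := isElliptic_congruentNumberCurve hn0
      ∀ T : (congruentNumberCurve n).toAffine.Point, (2 : ℕ) • T = 0 →
        twoDescentMap (splitTwoTorsion_cn n) R₀ ≠ twoDescentMap (splitTwoTorsion_cn n) T) :
    (congruentNumberCurve n).analyticRank = 1 ∧ (congruentNumberCurve n).mordellWeilRank = 1 ∧
      AddCommGroup.primaryComponent (congruentNumberCurve n).sha 2 = ⊥ ∧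
      BSDp (congruentNumberCurve n) 2 := by
  have hsq : Squarefree n :=
    hn ▸ squarefree_two_mul_prod_of_injective p hp (odd_of_two_mul_prod_mod_eight_six p hn h8) hinj
  obtain ⟨hr1, hrank, hbot, hiff⟩ :=
    rankOne_sha_bsdp_two_iff_halvingBits_congruentNumberCurve_two_mul_three_primes hGZK hMe p hp hinj hn
      h8 hs s hs2 hT
  refine ⟨hr1, hrank, hbot, hiff.mpr ⟨?_, ?_⟩⟩
  · exact (halvingBit_one_iff_twoDescentMap hn0 s).mpr ⟨T₁, hT₁, hδ₁⟩
  · exact not_halvingBit_two_of_twoDescentMap_ne hsq s R₀ T₀ hT₀ hR₀ hδ₂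

end Schema

end Summit.BirchSwinnertonDyer.Rank1Residual.P2

end
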